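import Mathlib

/-!
# PartN29 — free gap in the K₁ fibre (step (1) of LEMMA SHELL-LOG, memo ROTOR-THEORY-20 §267/§268)

Three free magnons on the `L × L` torus with total momentum `K₁ = (1,0)·2π/L`: unless the momenta are a
permutation of `(K₁, 0, 0)` (the three POLE states), the kinetic energy is at least `3 ε₁`,
`ε₁ = 1 - cos (2π/L)`.  Here: the typed statement `FreeGapK1` and the one-dimensional cosine facts it
reduces to (`eps1D_ge_epsMin`, `eps1D_ge_two_epsMin`).
-/

-- Port of theory seat `hubbard-h0-rotor-theory-1` cycle20/lean/PartN29.lean verbatim modulo this header,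
-- `set_option linter.dupNamespace false` and lint fixes; prover seat `hubbard-h0-rotor-p1` g21, `--supports stmt-HubbardSuperconductivity-19089`.
-- (Residue form of the same free gap, proved independently: `…Transfer.freeGap_K1` in `…TransferKreinFreeGap`.)

set_option linter.dupNamespace false

namespace Summit.HubbardSuperconductivity.HubbardSuperconductivity.Theorems.AnisotropyChord.Transfer.FreeGap

open Real

/-- one-dimensional lattice dispersion `1 - cos (2π m / L)` of a `ZMod L` momentum (via `val`). -/
noncomputable def eps1D (L : ℕ) (m : ZMod L) : ℝ := 1 - Real.cos (2 * π * (m.val : ℝ) / L)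

/-- `ε(k) = 2 - cos kₓ - cos k_y`. -/
noncomputable def eps (L : ℕ) (k : ZMod L × ZMod L) : ℝ := eps1D L k.1 + eps1D L k.2

/-- `ε₁ = 1 - cos (2π / L)`. -/
noncomputable def epsMin (L : ℕ) : ℝ := 1 - Real.cos (2 * π / L)

/-- `K₁ = (1, 0)`. -/
def K1 (L : ℕ) : ZMod L × ZMod L := (1, 0)

/-- pole configurations: permutations of `(K₁, 0, 0)`. -/
def IsPole (L : ℕ) (k₁ k₂ k₃ : ZMod L × ZMod L) : Prop :=
  (k₁ = K1 L ∧ k₂ = 0 ∧ k₃ = 0) ∨ (k₁ = 0 ∧ k₂ = K1 L ∧ k₃ = 0) ∨ (k₁ = 0 ∧ k₂ = 0 ∧ k₃ = K1 L)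

/-- LEMMA (free gap in the K₁ fibre). -/
def FreeGapK1 : Prop :=
  ∀ (L : ℕ) [NeZero L], 4 ≤ L → ∀ k₁ k₂ k₃ : ZMod L × ZMod L,
    k₁ + k₂ + k₃ = K1 L → ¬ IsPole L k₁ k₂ k₃ → 3 * epsMin L ≤ eps L k₁ + eps L k₂ + eps L k₃

/-! ### one-dimensional facts -/

/-- `sin a ≤ sin x` on the window `a ≤ x ≤ π - a` (with `0 ≤ a`). -/
theorem sin_le_sin_of_window {a x : ℝ} (ha : 0 ≤ a) (h1 : a ≤ x) (h2 : x ≤ π - a) :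
    Real.sin a ≤ Real.sin x := by
  by_cases hx : x ≤ π / 2
  · exact Real.sin_le_sin_of_le_of_le_pi_div_two (by linarith [Real.pi_pos]) hx h1
  · rw [not_le] at hx
    have h := Real.sin_pi_sub x
    rw [← h]
    exact Real.sin_le_sin_of_le_of_le_pi_div_two (by linarith [Real.pi_pos]) (by linarith) (by linarith)

/-- `1 − cos 2y = 2 sin² y`. [folklore] -/
theorem one_sub_cos_eq (y : ℝ) : 1 - Real.cos (2 * y) = 2 * Real.sin y ^ 2 := by
  rw [Real.cos_two_mul, Real.cos_sq']; ring

/-- `ε₁ᴰ ≥ 0`. [folklore] -/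
theorem eps1D_nonneg (L : ℕ) (m : ZMod L) : 0 ≤ eps1D L m := by
  unfold eps1D; linarith [Real.cos_le_one (2 * π * (m.val : ℝ) / L)]

/-- (F1) a nonzero 1D momentum costs at least `ε₁`: for `1 ≤ m ≤ L - 1`,
`1 - cos (2π m/L) ≥ 1 - cos (2π/L)`. -/
theorem one_sub_cos_ge_of_range (L m : ℕ) (hL : 2 ≤ L) (h1 : 1 ≤ m) (h2 : m + 1 ≤ L) :
    1 - Real.cos (2 * π / L) ≤ 1 - Real.cos (2 * π * (m : ℝ) / L) := by
  have hLpos : (0 : ℝ) < L := by exact_mod_cast (by omega : 0 < L)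
  have e1 : 2 * π / (L : ℝ) = 2 * (π / L) := by ring
  have e2 : 2 * π * (m : ℝ) / L = 2 * (π * m / L) := by ring
  rw [e1, e2, one_sub_cos_eq, one_sub_cos_eq]
  have hm1 : (1 : ℝ) ≤ m := by exact_mod_cast h1
  have hm2 : (m : ℝ) + 1 ≤ L := by exact_mod_cast h2
  have ha : 0 ≤ π / (L : ℝ) := by positivity
  have hw1 : π / (L : ℝ) ≤ π * m / L := by
    rw [div_le_div_iff_of_pos_right hLpos]; nlinarith [Real.pi_pos]
  have hw2 : π * (m : ℝ) / L ≤ π - π / L := by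
    rw [show π - π / (L : ℝ) = π * (L - 1) / L by field_simp]
    rw [div_le_div_iff_of_pos_right hLpos]; nlinarith [Real.pi_pos]
  have hs := sin_le_sin_of_window ha hw1 hw2
  have hs0 : 0 ≤ Real.sin (π / (L : ℝ)) := by
    apply Real.sin_nonneg_of_nonneg_of_le_pi ha
    have : π / (L : ℝ) ≤ π := by
      rw [div_le_iff₀ hLpos]; nlinarith [Real.pi_pos, show (2:ℝ) ≤ L by exact_mod_cast hL]
    exact this
  nlinarith [hs, hs0]

/-- (F2) a 1D momentum outside `{0, ±1}` costs at least `2 ε₁` when `L ≥ 4`: for `2 ≤ m ≤ L - 2`,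
`1 - cos (2π m/L) ≥ 2 (1 - cos (2π/L))`. -/
theorem one_sub_cos_ge_two_of_range (L m : ℕ) (hL : 4 ≤ L) (h1 : 2 ≤ m) (h2 : m + 2 ≤ L) :
    2 * (1 - Real.cos (2 * π / L)) ≤ 1 - Real.cos (2 * π * (m : ℝ) / L) := by
  have hLpos : (0 : ℝ) < L := by exact_mod_cast (by omega : 0 < L)
  have hL' : (4 : ℝ) ≤ L := by exact_mod_cast hL
  have e1 : 2 * π / (L : ℝ) = 2 * (π / L) := by ring
  have e2 : 2 * π * (m : ℝ) / L = 2 * (π * m / L) := by ring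
  rw [e1, e2, one_sub_cos_eq, one_sub_cos_eq]
  have hm1 : (2 : ℝ) ≤ m := by exact_mod_cast h1
  have hm2 : (m : ℝ) + 2 ≤ L := by exact_mod_cast h2
  -- sin (π m / L) ≥ sin (2π / L) = 2 sin(π/L) cos(π/L), and cos(π/L)² ≥ 1/2.
  have ha : 0 ≤ 2 * π / (L : ℝ) := by positivity
  have hw1 : 2 * π / (L : ℝ) ≤ π * m / L := by
    rw [div_le_div_iff_of_pos_right hLpos]; nlinarith [Real.pi_pos]
  have hw2 : π * (m : ℝ) / L ≤ π - 2 * π / L := by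
    rw [show π - 2 * π / (L : ℝ) = π * (L - 2) / L by field_simp]
    rw [div_le_div_iff_of_pos_right hLpos]; nlinarith [Real.pi_pos]
  have hs := sin_le_sin_of_window ha hw1 hw2
  have hdouble : Real.sin (2 * π / (L : ℝ)) = 2 * Real.sin (π / L) * Real.cos (π / L) := by
    rw [show 2 * π / (L : ℝ) = 2 * (π / L) by ring, Real.sin_two_mul]
  have hx1 : π / (L : ℝ) ≤ π / 4 := by
    rw [div_le_div_iff_of_pos_left Real.pi_pos hLpos (by norm_num)]; exact hL'
  have hx0 : 0 ≤ π / (L : ℝ) := by positivity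
  have hc : Real.cos (π / 4) ≤ Real.cos (π / (L : ℝ)) :=
    Real.cos_le_cos_of_nonneg_of_le_pi hx0 (by linarith [Real.pi_pos]) hx1
  rw [Real.cos_pi_div_four] at hc
  have hc0 : 0 ≤ Real.cos (π / (L : ℝ)) := le_trans (by positivity) hc
  have hs0 : 0 ≤ Real.sin (π / (L : ℝ)) :=
    Real.sin_nonneg_of_nonneg_of_le_pi hx0 (by linarith [Real.pi_pos])
  have hsq : (1 : ℝ) / 2 ≤ Real.cos (π / (L : ℝ)) ^ 2 := by
    have h2 : Real.sqrt 2 ^ 2 = 2 := Real.sq_sqrt (by norm_num)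
    nlinarith [hc, h2, Real.sqrt_nonneg 2]
  have hs2 : 0 ≤ Real.sin (2 * π / (L : ℝ)) := by rw [hdouble]; positivity
  -- sin(πm/L)² ≥ sin(2π/L)² = 4 sin² cos² ≥ 2 sin²(π/L)
  have hA : Real.sin (2 * π / (L : ℝ)) ^ 2 ≤ Real.sin (π * m / L) ^ 2 := by
    nlinarith [hs, hs2]
  rw [hdouble] at hA
  nlinarith [hA, hsq, sq_nonneg (Real.sin (π / (L : ℝ)))]

/-- a nonzero `ZMod L` momentum has `1 ≤ val ≤ L - 1`, hence `eps1D ≥ ε₁`. -/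
theorem eps1D_ge_epsMin (L : ℕ) [NeZero L] (hL : 2 ≤ L) (m : ZMod L) (hm : m ≠ 0) :
    epsMin L ≤ eps1D L m := by
  unfold epsMin eps1D
  have hv : m.val ≠ 0 := by rwa [ne_eq, ZMod.val_eq_zero]
  have hlt : m.val < L := ZMod.val_lt m
  exact one_sub_cos_ge_of_range L m.val hL (by omega) (by omega)

/-- a `ZMod L` momentum outside `{0, 1, -1}` has `2 ≤ val ≤ L - 2`, hence `eps1D ≥ 2 ε₁` (`L ≥ 4`). -/
theorem eps1D_ge_two_epsMin (L : ℕ) [NeZero L] (hL : 4 ≤ L) (m : ZMod L)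
    (h0 : m ≠ 0) (h1 : m ≠ 1) (hm1 : m ≠ -1) :
    2 * epsMin L ≤ eps1D L m := by
  unfold epsMin eps1D
  have hv0 : m.val ≠ 0 := by rwa [ne_eq, ZMod.val_eq_zero]
  have hlt : m.val < L := ZMod.val_lt m
  have hfact : Fact (1 < L) := ⟨by omega⟩
  have hv1 : m.val ≠ 1 := by
    intro h
    apply h1
    have := ZMod.natCast_zmod_val m
    rw [h] at this; simpa using this.symm
  have hvL : m.val ≠ L - 1 := by
    intro h
    apply hm1
    have hc := ZMod.natCast_zmod_val m
    rw [h] at hc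
    rw [← hc]
    have : ((L - 1 : ℕ) : ZMod L) = -1 := by
      rw [Nat.cast_sub (by omega), Nat.cast_one, ZMod.natCast_self]; ring
    exact this
  exact one_sub_cos_ge_two_of_range L m.val hL (by omega) (by omega)

/-- a nonzero 2D momentum costs at least `ε₁`. -/
theorem eps_ge_epsMin (L : ℕ) [NeZero L] (hL : 2 ≤ L) (k : ZMod L × ZMod L) (hk : k ≠ 0) :
    epsMin L ≤ eps L k := by
  unfold eps
  by_cases h1 : k.1 = 0
  · have h2 : k.2 ≠ 0 := by
      intro h2; apply hk; exact Prod.ext h1 h2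
    linarith [eps1D_ge_epsMin L hL k.2 h2, eps1D_nonneg L k.1]
  · linarith [eps1D_ge_epsMin L hL k.1 h1, eps1D_nonneg L k.2]

/-! ### assembly -/

/-- in `ZMod L`, `L ≥ 4`: the element `2` is none of `0, 1, -1`. -/
theorem two_ne (L : ℕ) [NeZero L] (hL : 4 ≤ L) :
    (2 : ZMod L) ≠ 0 ∧ (2 : ZMod L) ≠ 1 ∧ (2 : ZMod L) ≠ -1 := by
  have ndv : ∀ a : ℕ, 0 < a → a < L → ((a : ℕ) : ZMod L) ≠ 0 := by
    intro a ha haL h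
    rw [CharP.cast_eq_zero_iff (ZMod L) L a] at h
    have := Nat.le_of_dvd ha h
    omega
  have h1 : (1 : ZMod L) ≠ 0 := by
    have := ndv 1 (by norm_num) (by omega); simpa using this
  have h2 : (2 : ZMod L) ≠ 0 := by
    have := ndv 2 (by norm_num) (by omega); simpa using this
  have h3 : (3 : ZMod L) ≠ 0 := by
    have := ndv 3 (by norm_num) (by omega); simpa using this
  refine ⟨h2, ?_, ?_⟩
  · intro h; apply h1
    have e : (1 : ZMod L) = 2 - 1 := by ring
    rw [e, h]; ring
  · intro h; apply h3
    have e : (3 : ZMod L) = 2 + 1 := by ring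
    rw [e, h]; ring

/-- the «one zero momentum» case: `k + k' = K₁`, both nonzero ⇒ `ε(k) + ε(k') ≥ 3ε₁`. -/
theorem pair_case (L : ℕ) [NeZero L] (hL : 4 ≤ L) (k k' : ZMod L × ZMod L)
    (hsum : k + k' = K1 L) (hk : k ≠ 0) (hk' : k' ≠ 0) :
    3 * epsMin L ≤ eps L k + eps L k' := by
  have hL2 : 2 ≤ L := by omega
  have hs1 : k.1 + k'.1 = 1 := by
    have := congrArg Prod.fst hsum; simpa [K1] using this
  have hs2 : k.2 + k'.2 = 0 := by
    have := congrArg Prod.snd hsum; simpa [K1] using this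
  unfold eps
  by_cases hy : k.2 = 0
  · -- both second components vanish; first components (a, 1 - a) with a ∉ {0, 1}
    have hy' : k'.2 = 0 := by rw [hy, zero_add] at hs2; exact hs2
    have hx : k.1 ≠ 0 := by intro h; apply hk; exact Prod.ext h hy
    have hx' : k'.1 ≠ 0 := by intro h; apply hk'; exact Prod.ext h hy'
    have hx1 : k.1 ≠ 1 := by
      intro h; apply hx'; rw [h] at hs1
      linear_combination hs1
    have hx1' : k'.1 ≠ 1 := by
      intro h; apply hx; rw [h] at hs1
      linear_combination hs1
    obtain ⟨t0, t1, tm1⟩ := two_ne L hL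
    by_cases hm : k.1 = -1
    · have h2 : k'.1 = 2 := by
        have : k'.1 = 1 - k.1 := by rw [← hs1]; ring
        rw [this, hm]; ring
      have A := eps1D_ge_two_epsMin L hL k'.1 (by rw [h2]; exact t0) (by rw [h2]; exact t1)
        (by rw [h2]; exact tm1)
      have B := eps1D_ge_epsMin L hL2 k.1 hx
      linarith [eps1D_nonneg L k.2, eps1D_nonneg L k'.2]
    · have A := eps1D_ge_two_epsMin L hL k.1 hx hx1 hm
      have B := eps1D_ge_epsMin L hL2 k'.1 hx'
      linarith [eps1D_nonneg L k.2, eps1D_nonneg L k'.2]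
  · have hyy : k'.2 ≠ 0 := by
      intro h; apply hy; rw [h, add_zero] at hs2; exact hs2
    have A := eps1D_ge_epsMin L hL2 k.2 hy
    have B := eps1D_ge_epsMin L hL2 k'.2 hyy
    -- first components: not both zero
    by_cases hx : k.1 = 0
    · have hx' : k'.1 ≠ 0 := by
        intro h; rw [hx, h, zero_add] at hs1
        exact (two_ne L hL).2.1.symm (by
          -- 0 = 1 impossible
          exfalso
          have h1 : (1 : ZMod L) ≠ 0 := by
            intro e
            have := (CharP.cast_eq_zero_iff (ZMod L) L 1)
            simp only [Nat.cast_one] at this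
            have := Nat.le_of_dvd (by norm_num) (this.mp e); omega
          exact h1 hs1.symm)
      have C := eps1D_ge_epsMin L hL2 k'.1 hx'
      linarith [eps1D_nonneg L k.1]
    · have C := eps1D_ge_epsMin L hL2 k.1 hx
      linarith [eps1D_nonneg L k'.1]

/-- `ε(0) = 0`. [folklore] -/
theorem eps_zero (L : ℕ) [NeZero L] : eps L 0 = 0 := by
  simp [eps, eps1D]

/-- THEOREM: the free gap in the K₁ fibre. -/
theorem freeGapK1_holds : FreeGapK1 := by
  intro L _ hL k₁ k₂ k₃ hsum hpole
  have hL2 : 2 ≤ L := by omega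
  by_cases h1 : k₁ = 0 <;> by_cases h2 : k₂ = 0 <;> by_cases h3 : k₃ = 0
  · exact absurd (Or.inr (Or.inr ⟨h1, h2, by simpa [h1, h2] using hsum⟩)) hpole
  · exact absurd (Or.inr (Or.inr ⟨h1, h2, by simpa [h1, h2] using hsum⟩)) hpole
  · exact absurd (Or.inr (Or.inl ⟨h1, by simpa [h1, h3] using hsum, h3⟩)) hpole
  · -- k₁ = 0, k₂ k₃ ≠ 0
    have hs : k₂ + k₃ = K1 L := by simpa [h1] using hsum
    have := pair_case L hL k₂ k₃ hs h2 h3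
    rw [h1, eps_zero]; linarith
  · exact absurd (Or.inl ⟨by simpa [h2, h3] using hsum, h2, h3⟩) hpole
  · have hs : k₁ + k₃ = K1 L := by simpa [h2] using hsum
    have := pair_case L hL k₁ k₃ hs h1 h3
    rw [h2, eps_zero]; linarith
  · have hs : k₁ + k₂ = K1 L := by simpa [h3] using hsum
    have := pair_case L hL k₁ k₂ hs h1 h2
    rw [h3, eps_zero]; linarith
  · have A := eps_ge_epsMin L hL2 k₁ h1
    have B := eps_ge_epsMin L hL2 k₂ h2
    have C := eps_ge_epsMin L hL2 k₃ h3
    linarith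

end Summit.HubbardSuperconductivity.HubbardSuperconductivity.Theorems.AnisotropyChord.Transfer.FreeGap
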